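import Summits.CriticalPhenomena.SAWScalingLimit.Theorems.SAWRenewalTightnessTubeLowerBoundProfilePotentialDefs
import Mathlib.Analysis.SpecialFunctions.Pow.Real

/-!
# Crux `TubeLowerBound` (stmt-CriticalPhenomena-4730), line `profile-potential`: stub `stub_cornerFloor_of_cut`

Stub S4 of the checked skeleton of the line `profile-potential` (lead a1), PROVED outright:

* `stub_cornerFloor_of_cut : QuadrantCut → QuadrantDivergence → QuadrantProfileBound → CornerCrossingFloor`.

The three quadrant statements of the Defs file (S1 the fugacity-free first-exit cut in the quadrant,
S2 the divergence of the critical corner susceptibility, S3 the profile ratio ceiling) are taken as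
HYPOTHESES; the output is the landed `LiebSimonStar.CornerCrossingFloor` with aspect `K = 1`, the
exponent `C` of S3 and constant `c = 1 / (4 A 2^C)`.  Pure finite-sum calculus (Simon–Lieb /
Hammersley renewal bookkeeping, cf. N. Madras, G. Slade, *The Self-Avoiding Walk* (1993) §1.5):

1. multiply the cut at length `n` by `x_c^n = x_c^k x_c^{n-k}`, sum over `n ≤ N` and bound the
   triangle `k ≤ n ≤ N` by the square (`CornerFloorOfCutProof.triangle_sum_le`):
   `P_N ≤ SQ_N + 2 Θ_N P'_N`;
2. `squareWalks R n = ∅` for `n ≥ (R+1)²` (pigeonhole on the `(R+1)²` sites of `[0,R]²`), so the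
   square series is bounded by the constant `S = Σ_{n<(R+1)²} s_n x_c^n`;
3. at a cut-off `N ≥ N₀(R)` with `P_N ≥ 2 S + 2` (S2, monotone partial sums) the profile bound
   `P'_N ≤ A (R+2)^C P_N` gives `Θ_N ≥ 1 / (4 A (R+2)^C) ≥ c a^{-C}` for `a = R + 1`;
4. the east first-exit prefixes `cornerExitEast R k` lie in `CornerCrossingFloor`'s family at
   `a = R+1`, `K = 1`, so `Θ_N` is at most its double sum at the same `N`.
-/

noncomputable section

namespace Summit.CriticalPhenomena.SAWScalingLimit.Theorems.TubeLowerBound.ProfilePotential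

open scoped BigOperators Classical
open Literature.Probability.LatticeModels
open Literature.Probability.RandomPlanarGeometry Literature.Probability.RandomPlanarGeometry.SAW
open Summit.CriticalPhenomena.SAWScalingLimit.Theorems.TubeLowerBound.LiebSimonStar

namespace CornerFloorOfCutProof

/-! ### Finite-sum calculus -/

/-- The triangle `{k ≤ n ≤ N}` of a discrete convolution of nonnegative sequences is bounded by the
square: `Σ_{n≤M} Σ_{k≤n} F k · G (n−k) ≤ (Σ_{k≤M} F k) (Σ_{m≤M} G m)`. -/
theorem triangle_sum_le (F G : ℕ → ℝ) (hF : ∀ n, 0 ≤ F n) (hG : ∀ n, 0 ≤ G n) (M : ℕ) :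
    ∑ n ∈ Finset.range (M + 1), ∑ k ∈ Finset.range (n + 1), F k * G (n - k) ≤
      (∑ k ∈ Finset.range (M + 1), F k) * ∑ m ∈ Finset.range (M + 1), G m := by
  -- adapted from `AnnularMassDecay.Negative.triangle_sum_le` (HalfPlaneDivergence.lean)
  have hswap : ∑ n ∈ Finset.range (M + 1), ∑ k ∈ Finset.range (n + 1), F k * G (n - k) =
      ∑ k ∈ Finset.range (M + 1), ∑ n ∈ Finset.Ico k (M + 1), F k * G (n - k) := by
    refine Finset.sum_comm' fun n k => ?_
    simp only [Finset.mem_range, Finset.mem_Ico]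
    omega
  rw [hswap, Finset.sum_mul]
  refine Finset.sum_le_sum fun k _ => ?_
  rw [Finset.sum_Ico_eq_sum_range, ← Finset.mul_sum]
  refine mul_le_mul_of_nonneg_left ?_ (hF k)
  calc ∑ j ∈ Finset.range (M + 1 - k), G (k + j - k)
      = ∑ j ∈ Finset.range (M + 1 - k), G j :=
        Finset.sum_congr rfl fun j _ => by rw [Nat.add_sub_cancel_left]
    _ ≤ ∑ m ∈ Finset.range (M + 1), G m :=
        Finset.sum_le_sum_of_subset_of_nonneg (Finset.range_mono (Nat.sub_le _ _)) fun m _ _ => hG m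

/-- Step (1) for abstract sequences: summing a length-by-length cut inequality
`q_n ≤ s_n + 2 Σ_{k≤n} e_k q'_{n−k}` with weights `x^n = x^k x^{n−k}` over `n ≤ N` gives
`P_N ≤ SQ_N + 2 Θ_N P'_N` for the partial sums. -/
theorem partial_sum_cut {q s e q' : ℕ → ℝ} {x : ℝ} (hx : 0 ≤ x) (he : ∀ k, 0 ≤ e k)
    (hq' : ∀ m, 0 ≤ q' m)
    (hcut : ∀ n, q n ≤ s n + 2 * ∑ k ∈ Finset.range (n + 1), e k * q' (n - k)) (N : ℕ) :
    ∑ n ∈ Finset.range (N + 1), q n * x ^ n ≤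
      ∑ n ∈ Finset.range (N + 1), s n * x ^ n +
        2 * (∑ k ∈ Finset.range (N + 1), e k * x ^ k) *
          ∑ m ∈ Finset.range (N + 1), q' m * x ^ m := by
  have hterm : ∀ n, q n * x ^ n ≤ s n * x ^ n +
      2 * ∑ k ∈ Finset.range (n + 1), (e k * x ^ k) * (q' (n - k) * x ^ (n - k)) := by
    intro n
    calc q n * x ^ n ≤ (s n + 2 * ∑ k ∈ Finset.range (n + 1), e k * q' (n - k)) * x ^ n :=
          mul_le_mul_of_nonneg_right (hcut n) (pow_nonneg hx n)
      _ = s n * x ^ n +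
            2 * ∑ k ∈ Finset.range (n + 1), (e k * x ^ k) * (q' (n - k) * x ^ (n - k)) := by
          rw [add_mul, mul_assoc, Finset.sum_mul]
          congr 2
          refine Finset.sum_congr rfl fun k hk => ?_
          rw [Finset.mem_range] at hk
          have hxn : x ^ n = x ^ k * x ^ (n - k) := by
            rw [← pow_add]
            congr 1
            omega
          rw [hxn]
          ring
  have hF : ∀ k, 0 ≤ e k * x ^ k := fun k => mul_nonneg (he k) (pow_nonneg hx k)
  have hG : ∀ m, 0 ≤ q' m * x ^ m := fun m => mul_nonneg (hq' m) (pow_nonneg hx m)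
  calc ∑ n ∈ Finset.range (N + 1), q n * x ^ n
      ≤ ∑ n ∈ Finset.range (N + 1), (s n * x ^ n +
          2 * ∑ k ∈ Finset.range (n + 1), (e k * x ^ k) * (q' (n - k) * x ^ (n - k))) :=
        Finset.sum_le_sum fun n _ => hterm n
    _ = ∑ n ∈ Finset.range (N + 1), s n * x ^ n +
          2 * ∑ n ∈ Finset.range (N + 1), ∑ k ∈ Finset.range (n + 1),
            (e k * x ^ k) * (q' (n - k) * x ^ (n - k)) := by
        rw [Finset.sum_add_distrib, Finset.mul_sum]
    _ ≤ ∑ n ∈ Finset.range (N + 1), s n * x ^ n +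
          2 * ((∑ k ∈ Finset.range (N + 1), e k * x ^ k) *
            ∑ m ∈ Finset.range (N + 1), q' m * x ^ m) :=
        add_le_add le_rfl (mul_le_mul_of_nonneg_left
          (triangle_sum_le (fun k => e k * x ^ k) (fun m => q' m * x ^ m) hF hG N)
          (by norm_num : (0 : ℝ) ≤ 2))
    _ = _ := by ring

/-- Partial sums of a nonnegative sequence vanishing from `M` on are bounded by the sum below `M`. -/
theorem sum_range_le_of_vanish {f : ℕ → ℝ} {M : ℕ} (hf : ∀ n, 0 ≤ f n)
    (hz : ∀ n, M ≤ n → f n = 0) (N : ℕ) :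
    ∑ n ∈ Finset.range (N + 1), f n ≤ ∑ n ∈ Finset.range M, f n := by
  calc ∑ n ∈ Finset.range (N + 1), f n
      ≤ ∑ n ∈ Finset.range (N + 1) ∪ Finset.range M, f n :=
        Finset.sum_le_sum_of_subset_of_nonneg Finset.subset_union_left fun n _ _ => hf n
    _ = ∑ n ∈ Finset.range M, f n := by
        refine (Finset.sum_subset Finset.subset_union_right fun n _ hnM => hz n ?_).symm
        rw [Finset.mem_range, not_lt] at hnM
        exact hnM

/-- Step (3), the arithmetic: from `P ≤ S + 2 Θ P'`, `P' ≤ B P`, `2 S + 2 ≤ P`, `S ≥ 0`, `Θ ≥ 0`,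
`B > 0` we get `Θ ≥ 1 / (4 B)`. -/
theorem floor_of_ineqs {P P' Θ S B : ℝ} (hcut : P ≤ S + 2 * Θ * P') (hprof : P' ≤ B * P)
    (hP : 2 * S + 2 ≤ P) (hS : 0 ≤ S) (hΘ : 0 ≤ Θ) (hB : 0 < B) : 1 / (4 * B) ≤ Θ := by
  have hPpos : 0 < P := by linarith
  have h1 : P ≤ S + 2 * Θ * (B * P) :=
    hcut.trans (add_le_add le_rfl (mul_le_mul_of_nonneg_left hprof (by positivity : 0 ≤ 2 * Θ)))
  rw [div_le_iff₀ (by positivity)]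
  by_contra hlt
  have h2 : Θ * (4 * B) * P < 1 * P := mul_lt_mul_of_pos_right (not_le.1 hlt) hPpos
  nlinarith

/-- Step (3→4), the constants: `(1 / (4 A 2^C)) · a^{−C} ≤ 1 / (4 A (R+2)^C)` for `a = R + 1`
(`R + 2 ≤ 2 (R + 1)` and monotonicity of `t ↦ t^C`, `C ≥ 0`). -/
theorem const_le {A C : ℝ} (hA : 1 ≤ A) (hC : 0 ≤ C) (R : ℕ) :
    1 / (4 * A * (2 : ℝ) ^ C) * ((R + 1 : ℕ) : ℝ) ^ (-C) ≤ 1 / (4 * (A * ((R : ℝ) + 2) ^ C)) := by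
  have hR : (0 : ℝ) ≤ R := Nat.cast_nonneg R
  have hA0 : 0 < A := by linarith
  have hR1 : (0 : ℝ) ≤ (R : ℝ) + 1 := by positivity
  push_cast
  rw [Real.rpow_neg hR1, ← div_eq_mul_inv, div_div]
  refine one_div_le_one_div_of_le (by positivity) ?_
  have hmono : ((R : ℝ) + 2) ^ C ≤ (2 * ((R : ℝ) + 1)) ^ C :=
    Real.rpow_le_rpow (by positivity) (by linarith) hC
  calc 4 * (A * ((R : ℝ) + 2) ^ C) ≤ 4 * (A * (2 * ((R : ℝ) + 1)) ^ C) :=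
        mul_le_mul_of_nonneg_left (mul_le_mul_of_nonneg_left hmono hA0.le) (by norm_num)
    _ = 4 * A * (2 : ℝ) ^ C * ((R : ℝ) + 1) ^ C := by
        rw [Real.mul_rpow (by norm_num) hR1]
        ring

/-! ### The two combinatorial facts -/

/-- Step (2): a self-avoiding walk confined to the square `[0,R]²` has fewer than `(R+1)²` steps
(it visits `n + 1` distinct sites of a set of `(R+1)²` sites), so `squareWalks R n = ∅` for
`n ≥ (R+1)²`. -/
theorem squareWalks_eq_empty {R n : ℕ} (hn : (R + 1) ^ 2 ≤ n) : squareWalks R n = ∅ := by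
  -- adapted from `LiebSimon.find_exit_props` (…TubeLowerBoundQuarterFlux.lean)
  refine Finset.eq_empty_of_forall_notMem fun ω hω => ?_
  rw [squareWalks, Finset.mem_filter] at hω
  obtain ⟨hω, hbox⟩ := hω
  obtain ⟨-, -, -, hinj⟩ := Zd.mem_saws.1 hω
  have hle := Finset.card_le_card_of_injOn ω (s := Finset.range (n + 1))
    (t := Fintype.piFinset fun _ : Fin 2 => Finset.Icc (0 : ℤ) R) (fun i hi => ?_)
    (fun i hi j hj hij => ?_)
  · rw [Finset.card_range, Fintype.card_piFinset_const, Int.card_Icc] at hle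
    have h2 : ((R : ℤ) + 1 - 0).toNat = R + 1 := by omega
    rw [h2] at hle
    exact Nat.not_succ_le_self n (hle.trans hn)
  · rw [Finset.coe_range, Set.mem_Iio] at hi
    have h := hbox i (Nat.lt_succ_iff.1 hi)
    rw [Finset.mem_coe, Fintype.mem_piFinset, Fin.forall_fin_two, Finset.mem_Icc, Finset.mem_Icc]
    omega
  · rw [Finset.coe_range, Set.mem_Iio] at hi hj
    exact hinj (by simp only [Set.mem_setOf_eq]; omega) (by simp only [Set.mem_setOf_eq]; omega) hij

/-- Hence the weighted square count vanishes from `(R+1)²` on. -/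
theorem squareWalks_term_eq_zero {R n : ℕ} (hn : (R + 1) ^ 2 ≤ n) (x : ℝ) :
    ((squareWalks R n).card : ℝ) * x ^ n = 0 := by
  rw [squareWalks_eq_empty hn, Finset.card_empty, Nat.cast_zero, zero_mul]

/-- Step (4): an east first-exit prefix of `[0,R]²` is a member of `CornerCrossingFloor`'s family at
width `a = R + 1` and aspect `K = 1` (for `i < k` the square bounds, for `i = k` the three end
conjuncts of `cornerExitEast`). -/
theorem mem_target_of_mem_cornerExitEast {R k : ℕ} {ω : ℕ → Site 2} (hω : ω ∈ cornerExitEast R k) :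
    ω ∈ Zd.saws 2 k ∧ ((∀ i ≤ k, 0 ≤ ω i 0 ∧ ω i 0 ≤ ((R + 1 : ℕ) : ℤ) ∧ 0 ≤ ω i 1 ∧
      ω i 1 ≤ ((1 : ℕ) : ℤ) * ((R + 1 : ℕ) : ℤ)) ∧ ω k 0 = ((R + 1 : ℕ) : ℤ)) := by
  rw [cornerExitEast, Finset.mem_filter] at hω
  obtain ⟨hsaw, hbox, hend0, hend1, hend2⟩ := hω
  refine ⟨hsaw, fun i hi => ?_, by push_cast; omega⟩
  rcases Nat.lt_or_ge i k with hik | hik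
  · obtain ⟨h1, h2, h3, h4⟩ := hbox i hik
    push_cast
    omega
  · obtain rfl : i = k := le_antisymm hi hik
    push_cast
    omega

/-! ### Steps (1)–(3) on the concrete series -/

/-- Steps (1)+(2): `P_N ≤ S + 2 Θ_N P'_N` with the constant `S = Σ_{n<(R+1)²} s_n x_c^n`. -/
theorem summed_cut (hcut : QuadrantCut) (R N : ℕ) :
    ∑ n ∈ Finset.range (N + 1), ((quadWalks 0 n).card : ℝ) * criticalFugacity ^ n ≤
      ∑ n ∈ Finset.range ((R + 1) ^ 2), ((squareWalks R n).card : ℝ) * criticalFugacity ^ n +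
        2 * (∑ k ∈ Finset.range (N + 1), ((cornerExitEast R k).card : ℝ) * criticalFugacity ^ k) *
          ∑ n ∈ Finset.range (N + 1), ((quadWalks (R + 1) n).card : ℝ) * criticalFugacity ^ n := by
  have hx0 : (0 : ℝ) ≤ criticalFugacity := criticalFugacity_pos.le
  have h1 := partial_sum_cut (q := fun n => ((quadWalks 0 n).card : ℝ))
      (s := fun n => ((squareWalks R n).card : ℝ)) (e := fun k => ((cornerExitEast R k).card : ℝ))
      (q' := fun m => ((quadWalks (R + 1) m).card : ℝ)) hx0 (fun k => Nat.cast_nonneg _)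
      (fun m => Nat.cast_nonneg _) (hcut R) N
  have h2 : ∑ n ∈ Finset.range (N + 1), ((squareWalks R n).card : ℝ) * criticalFugacity ^ n ≤
      ∑ n ∈ Finset.range ((R + 1) ^ 2), ((squareWalks R n).card : ℝ) * criticalFugacity ^ n :=
    sum_range_le_of_vanish (f := fun n => ((squareWalks R n).card : ℝ) * criticalFugacity ^ n)
      (fun n => mul_nonneg (Nat.cast_nonneg _) (pow_nonneg hx0 n))
      (fun n hn => squareWalks_term_eq_zero hn _) N
  exact h1.trans (add_le_add h2 le_rfl)

/-- Step (3): at a cut-off `N` where the profile bound holds and `P_N ≥ 2 S + 2`, the east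
first-exit mass satisfies `Θ_N ≥ 1 / (4 A (R+2)^C)`. -/
theorem theta_floor (hcut : QuadrantCut) {A C : ℝ} (hA : 1 ≤ A) {R N : ℕ}
    (hprofN : ∑ n ∈ Finset.range (N + 1), ((quadWalks (R + 1) n).card : ℝ) * criticalFugacity ^ n ≤
      A * ((R : ℝ) + 2) ^ C *
        ∑ n ∈ Finset.range (N + 1), ((quadWalks 0 n).card : ℝ) * criticalFugacity ^ n)
    (hdivN : 2 * (∑ n ∈ Finset.range ((R + 1) ^ 2),
        ((squareWalks R n).card : ℝ) * criticalFugacity ^ n) + 2 ≤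
      ∑ n ∈ Finset.range (N + 1), ((quadWalks 0 n).card : ℝ) * criticalFugacity ^ n) :
    1 / (4 * (A * ((R : ℝ) + 2) ^ C)) ≤
      ∑ k ∈ Finset.range (N + 1), ((cornerExitEast R k).card : ℝ) * criticalFugacity ^ k := by
  have hx0 : (0 : ℝ) ≤ criticalFugacity := criticalFugacity_pos.le
  have hR : (0 : ℝ) ≤ R := Nat.cast_nonneg R
  have hA0 : 0 < A := by linarith
  exact floor_of_ineqs (summed_cut hcut R N) hprofN hdivN
    (Finset.sum_nonneg fun n _ => mul_nonneg (Nat.cast_nonneg _) (pow_nonneg hx0 n))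
    (Finset.sum_nonneg fun k _ => mul_nonneg (Nat.cast_nonneg _) (pow_nonneg hx0 k))
    (by positivity)

end CornerFloorOfCutProof

open CornerFloorOfCutProof in
/-- **S4 `stub_cornerFloor_of_cut`**: the quadrant cut (S1), the divergence of the critical corner
susceptibility (S2) and the profile ratio ceiling (S3, constants `A ≥ 1`, `C ≥ 0`) give
`CornerCrossingFloor` with `K = 1`, exponent `C` and `c = 1 / (4 A 2^C)`: for `a = R + 1` choose
`N ≥ N₀(R)` with `P_N ≥ 2 S + 2`; then `Θ_N ≥ 1 / (4 A (R+2)^C) ≥ c a^{−C}`, and `Θ_N` is at most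
the `CornerCrossingFloor` double sum (east first-exit prefixes are members of its family). -/
theorem stub_cornerFloor_of_cut :
    QuadrantCut → QuadrantDivergence → QuadrantProfileBound → CornerCrossingFloor := by
  intro hcut hdiv hprof
  obtain ⟨A, C, hA, hC, hprofR⟩ := hprof
  have hx0 : (0 : ℝ) ≤ criticalFugacity := criticalFugacity_pos.le
  have hA0 : 0 < A := by linarith
  refine ⟨1, C, 1 / (4 * A * (2 : ℝ) ^ C), hC, by positivity, fun a ha => ?_⟩
  obtain ⟨R, rfl⟩ : ∃ R, a = R + 1 := ⟨a - 1, by omega⟩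
  obtain ⟨N₀, hN₀⟩ := hprofR R
  obtain ⟨N₁, hN₁⟩ := hdiv (2 * (∑ n ∈ Finset.range ((R + 1) ^ 2),
    ((squareWalks R n).card : ℝ) * criticalFugacity ^ n) + 2)
  refine ⟨max N₀ N₁, ?_⟩
  have hdivN : 2 * (∑ n ∈ Finset.range ((R + 1) ^ 2),
      ((squareWalks R n).card : ℝ) * criticalFugacity ^ n) + 2 ≤
      ∑ n ∈ Finset.range (max N₀ N₁ + 1), ((quadWalks 0 n).card : ℝ) * criticalFugacity ^ n :=
    hN₁.trans (Finset.sum_le_sum_of_subset_of_nonneg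
      (Finset.range_mono (Nat.succ_le_succ (le_max_right N₀ N₁)))
      fun n _ _ => mul_nonneg (Nat.cast_nonneg _) (pow_nonneg hx0 n))
  calc 1 / (4 * A * (2 : ℝ) ^ C) * ((R + 1 : ℕ) : ℝ) ^ (-C)
      ≤ 1 / (4 * (A * ((R : ℝ) + 2) ^ C)) := const_le hA hC R
    _ ≤ ∑ k ∈ Finset.range (max N₀ N₁ + 1),
          ((cornerExitEast R k).card : ℝ) * criticalFugacity ^ k :=
        theta_floor hcut hA (hN₀ _ (le_max_left N₀ N₁)) hdivN
    _ ≤ _ := by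
        refine Finset.sum_le_sum fun k _ => ?_
        rw [Finset.sum_const, nsmul_eq_mul]
        refine mul_le_mul_of_nonneg_right ?_ (pow_nonneg hx0 k)
        refine Nat.cast_le.2 (Finset.card_le_card fun ω hω => ?_)
        rw [Finset.mem_filter]
        exact mem_target_of_mem_cornerExitEast hω

end Summit.CriticalPhenomena.SAWScalingLimit.Theorems.TubeLowerBound.ProfilePotential

end
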